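/-
Copyright: lit-balaban Phase-2 proof seat p08 (gen 9).  Statement-level skeleton of a published paper; no proof claims beyond what
the kernel checks below.
-/
import Literature.MathematicalPhysics.QuantumFieldTheory.BalabanImbrieJaffe1984to88.BIJ88CurlyDkLocGradTerm
import Literature.MathematicalPhysics.QuantumFieldTheory.BalabanImbrieJaffe1984to88.BIJ88OpDecay213DkLocTorus
import Literature.MathematicalPhysics.QuantumFieldTheory.BalabanImbrieJaffe1984to88.BIJ88Decay223CkAllTori

/-!
# `BalabanImbrieJaffe1984to88.BIJ88OpDecay213DkLocGradTorus` — T. Bałaban, J. Imbrie, A. Jaffe, *Effective action and cluster properties of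
the abelian Higgs model*, Commun. Math. Phys. **114** (1988) 257–315 [BalabanImbrieJaffe1988], Sect. 2 p. 261 [PDF 5]: **THE PRINTED
OPERATOR FORM OF THE DERIVATIVE CLAUSE OF (2.13)** — *"|(𝒟_{k,loc}f)(b)| ≦ ce^{−c dist(suppt f,b)}‖f‖_∞ (2.13) and similarly for derivatives of
𝒟_{k,loc}"* — **FOR THE CONCRETE TORUS OBJECT OF RECORD** (r18's `dkLocKer` with the `η^d`-weighted action of this seat's
`BIJ88OpDecay213DkLocTorus`): the `η`-lattice derivative `η⁻¹Δ_λ(𝒟_{k,loc}f)(b)` obeys the same bound for ALL `b`, no threshold, uniformly in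
`k` and in the radius schedule — per torus with NO hypothesis and over all tori with ONE set of constants given [6I] Prop. 1.2 by its tree name.

statement-level skeleton of published theorems with citation tags; proofs where landed; nothing here is a claim about the Yang–Mills mass gap

PDF held: `paper:balaban1988-cmp114-bij-abelian-higgs-effective-action` (journal page = PDF page + 256), p. 261 [PDF 5] (text layer re-read
this session); [I] = [BalabanImbrieJaffe1985] p. 325 [PDF 27] (7.2.2); [6I] = [Balaban1984PropagatorsI] Prop. 1.2 (tree name
`Balaban1983to89.B5.Prop12Printed`).

CITATION HEADER (lean-in-tree rule).  Part of the lit-balaban TYPED SKELETON (HOME `run/shared/lean/pub/lit-balaban/`), Phase-2 proof seat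
p08 (gen 9), unit `lit-balaban-p08`; free-target protocol G.5-34(d), TAKING line HOME/STATUS.md 2026-08-21T21:51:58Z (item (E)) and its
operator companion announced 22:0xZ.  WHAT IS REPRODUCED = SKELETON row **C2.Eq2.13** (owner r18, referee ref-5), the DERIVATIVE clause in
the printed OPERATOR shape, kind «model instance» for r18's (2.12) `dkLocKer`.  Decls used BY NAME (nothing restated): this seat's
`BIJ88CurlyDkLocGradTerm.abs_hlKer_shift_sub_le`/`exists_cutoffProfile_lipschitz`/`termKer_shift_sub_eq_sum`,
`BIJ88OpDecay213DkLocTorus.abs_applyK_le_of_weighted_rowsum`/`kdist_le_legs`/`sum_fineBond_exp_le`/`sum_bond_exp_neg_supDist_le`/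
`sum_bond_exp_neg_distEU_le`/`eta_pow_scaling`, `BIJ88CurlyDkLocDecayTorus.abs_hlKer_le_of_sup`/`abs_clKer_ambient_le`,
`BIJ88Decay223CkAllTori.exists_HB_allTori_of_prop12Printed`; r18's `dkLocKer`/`termKer`/`hlKer`/`clKer`/`kdist`/`dkLocKer_eq_sum`/`applyK`/
`supNorm`/`suppDist`; gen 7's `exists_bound_of_ineq722`/`torusKernelData_gradH`; p09's `ineq722_deltaA_of_prop12Printed`; p09 g8's
`cloc_decay`; p16's `prop12Printed_levStd_deltaA`.

THE PRINTED TEXT (p. 261 [PDF 5], verbatim): *"This propagator derives its regularity and decay from that of C^{(j)}_{loc} and H_{k,loc}.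
Thus |(𝒟_{k,loc}f)(b)| ≦ ce^{−c dist(suppt f,b)}‖f‖_∞ (2.13) and similarly for derivatives of 𝒟_{k,loc} and Hölder derivatives of order less
than 2."*  The mechanism is that of file B with the first factor replaced by the `η`-difference of `H_{j,loc}` (file E1's product rule): the
scale-`j` row sum against the exponential weight becomes `≲ L^k·L^{−j}·(L^{k−j})^{−2} = (L^{k−j})^{−1}` — still summable over the scales with
no distance threshold (the regime *"scaling factors Λ = L^{−1} < 1"* of p08 g4's `BIJ88MultiscaleDecay223.multiscale_sum_le_of_lt_one`).

WHAT IS PROVED (0 `sorry`, standard axioms; theorems only — proof lane; every `d ≥ 2`):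
* §1 `weighted_rowsum_triple_le₂` (file B's kernel-generic weighted row sum with two different outer kernels `h`, `h′`:
  `Σ_{b″}|Σ_{b₁b₂}h(b,b₁)C(b₁,b₂)h′(b″,b₂)|e^{a·dist_k(b″,b)} ≤ MM′M_C·d³e^{a/2}K(a)³·(L^j)^d`).
* §2 **`weighted_rowsum_gradTermLoc_le`**: for the object of record with the weight `η_k^d` and the derivative factor `L^k`,
  `Σ_{b″} η_k^dL^k|G^{(j),η}_{loc}(⟨x+e_λ,μ⟩,b″) − G^{(j),η}_{loc}(⟨x,μ⟩,b″)|e^{a·dist_k(b″,⟨x,μ⟩)} ≤ (1 + 16C_σ/ρ_j)M²M_C·d³e^{a/2}K(a)³·(L^{k−j})^{−1}`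
  (`η_k^d(L^{k−j})^{d−2}(L^j)^d·L^kL^{−j} = (L^{k−j})^{−1}`); **`weighted_rowsum_gradDkLoc_le`** (`Σ_{j<k}(L^{k−j})^{−1} ≤ 1`: the weighted row sums of
  the `η`-derivative of `𝒟_{k,loc}` are `≤ (1 + 16C_σ/ρ₀)M²M_C·d³e^{a/2}K(a)³`, uniform in `k ≤ m + K` and in schedules with `ρ_j ≥ ρ₀`).
* §3 **THE DERIVATIVE CLAUSE OF (2.13) AS PRINTED, FOR THE OBJECT OF RECORD**: `applyK_shift_sub` (the `η`-derivative of `𝒟_{k,loc}f` is the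
  operator of the `η`-differenced kernel), **`abs_apply_gradDkLoc_le`** (explicit: `L^k·|(𝒟_{k,loc}f)(⟨x+e_λ,μ⟩) − (𝒟_{k,loc}f)(⟨x,μ⟩)| ≤
  S′·e^{−a·dist_k(suppt f,⟨x,μ⟩)}‖f‖_∞` for ALL `x, μ, λ`), `opDecay213_gradDkLoc_of_ineq722`, **`opDecay213_gradDkLoc_prop12`**,
  **`opDecay213_gradDkLoc_torus`** (NO HYPOTHESIS, p16), **`opDecay213_gradDkLoc_allTori_of_prop12Printed`** (ONE `(c₂, δ′)` for every torus
  `(P.d = d, P.L = L)`, every `k ≤ m + K`, every schedule with `ρ_j ≥ ρ₀`, from the all-tori `B5.Prop12Printed`).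
HONEST SCOPE.  (i) The `η^d`-weighted action is file B's reading (its in-tree witnesses are quoted there); the derivative is the forward
`η`-lattice difference in the output argument times `η⁻¹ = L^k`; the Hölder clause is not treated.  (ii) Constants depend on the lower bound
`ρ₀ > 0` of the radii through `16C_σ/ρ₀` (`C_σ` an existential Lipschitz constant of Mathlib's `Real.smoothTransition`).  (iii) Remaining
hypotheses as in files C/E2: none per torus (p16), the all-tori `B5.Prop12Printed` for the uniform version (bridge p19/p30 in flight).  (iv)
`U = 1`, real abelian fields, torus, standing range.  (v) No `def`, no new named fact, nothing restated; NOT summit progress.  Unit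
`lit-balaban-p08` (literature-prover-lit-balaban-p08-g9-0), 2026-08-21.
-/

open scoped BigOperators RealInnerProductSpace

namespace Literature.MathematicalPhysics.QuantumFieldTheory.BalabanImbrieJaffe1984to88.BIJ88OpDecay213DkLocGradTorus

open Balaban1983to89 hiding Site Plaq
open Balaban1983to89.LatticeFieldCalculus
open BIJ88Ineq217Ineq722Torus (ofLp_HkE_single exists_bound_of_ineq722 torusKernelData_gradH_nonneg)
open BIJ85Eq721MinimizerKernel (torusKernelData_gradH)
open BIJ85Prop521Torus BIJ85Prop522Torus BIJ85Sigma422Eta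
open BIJ85Sect7Statements BIJ85Ineq722Torus
open BIJ85Ineq722DeltaA (deltaAData ineq722_deltaA_of_prop12Printed)
open BIJ85Ineq722ProofPart2 (settingOf)
open BIJ88ClocFactorsTorus (distB distB_apply)
open BIJ88ClocEstimatesTorus (Cloc cloc_decay)
open BIJ88Cutoffs21 (cutoffProfile)
open BIJ88Sect2Statements (applyK supNorm suppDist)
open BIJ88Close235Proof (supNorm_nonneg)
open BIJ85Prop12PerTower (prop12Printed_levStd_deltaA)
open BIJ88Decay223CkAllTori (exists_HB_allTori_of_prop12Printed)
open BIJ88CurlyDkLocTorus BIJ88CurlyDkLocDecayTorus BIJ88OpDecay213DkLocTorus BIJ88CurlyDkLocGradTerm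
-- inside this namespace the bare `Site`/`Plaq` are the `ℤ^d` carriers of the QFT root; the torus ones are renamed:
open Balaban1983to89 renaming Site → TSite, Plaq → TPlaq

noncomputable section

/-! ## §1  The weighted row sum with two outer kernels -/

section Generic

variable {P : Params}

/-- `0 < L^n`. [folklore] -/
private theorem cast_pow_L_pos' (n : ℕ) : (0 : ℝ) < (P.L : ℝ) ^ n := pow_pos P.cast_L_pos n

/-- `L^k = L^j·L^{k−j}` for `j ≤ k`. [folklore] -/
private theorem pow_eq_pow_mul_pow' {j k : ℕ} (hjk : j ≤ k) : (P.L : ℝ) ^ k = (P.L : ℝ) ^ j * (P.L : ℝ) ^ (k - j) := by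
  rw [← pow_add, Nat.add_sub_cancel' hjk]

/-- `c|D| = |cD|` for `c > 0`. [folklore] -/
private theorem mul_abs_of_pos {c D : ℝ} (hc : 0 < c) : c * |D| = |c * D| := by rw [abs_mul, abs_of_pos hc]

/-- **file B's weighted row sum, two outer kernels** (`j ≤ k`, `j ≤ m + K`): `|h(b,b₁)| ≤ Me^{−δ dist}`, `|h′(b″,b₂)| ≤ M′e^{−δ dist}`,
`|C(b₁,b₂)| ≤ M_Ce^{−δ_C|·|_∞}` ⟹ `Σ_{b″∈T_η}|Σ_{b₁b₂}h(b,b₁)C(b₁,b₂)h′(b″,b₂)|·e^{a·dist_k(b″,b)} ≤ MM′M_C·d³e^{a/2}K(a)³·(L^j)^d`, `a = min(δ,δ_C)/2`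
— the proof of `BIJ88OpDecay213DkLocTorus.weighted_rowsum_triple_le` verbatim with `h′` in the third slot. [cite: BalabanImbrieJaffe1988, (2.13) p.261] -/
theorem weighted_rowsum_triple_le₂ {j k : ℕ} (hj : j ≤ P.m + P.K) (hjk : j ≤ k) {δ M M' δC MC : ℝ} (hδ : 0 < δ) (hδC : 0 < δC)
    (hM : 0 ≤ M) (hM' : 0 ≤ M') (hMC : 0 ≤ MC) {h h' : PBond P 0 → PBond P j → ℝ} {C : PBond P j → PBond P j → ℝ}
    (hH : ∀ (b₀ : PBond P 0) (b₁ : PBond P j), |h b₀ b₁| ≤ M * Real.exp (-(δ * distEU P j b₀.src b₁.src)))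
    (hH' : ∀ (b₀ : PBond P 0) (b₁ : PBond P j), |h' b₀ b₁| ≤ M' * Real.exp (-(δ * distEU P j b₀.src b₁.src)))
    (hC : ∀ b₁ b₂ : PBond P j, |C b₁ b₂| ≤ MC * Real.exp (-(δC * (supDist b₁.src b₂.src : ℝ))))
    (b : PBond P 0) :
    ∑ b'' : PBond P 0, |∑ b₁ : PBond P j, ∑ b₂ : PBond P j, h b b₁ * C b₁ b₂ * h' b'' b₂| *
        Real.exp (min δ δC / 2 * kdist (P := P) k b'' b) ≤
      M * M' * MC * (P.d : ℝ) ^ 3 * (Real.exp (min δ δC / 2 / 2) * ((2 * (1 + P.d / (min δ δC / 2))) ^ P.d) ^ 3) *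
        ((P.L : ℝ) ^ j) ^ P.d := by
  have ha : 0 < min δ δC / 2 := half_pos (lt_min hδ hδC)
  have haδ : min δ δC / 2 ≤ δ - min δ δC / 2 := by linarith [min_le_left δ δC]
  have haC : min δ δC / 2 ≤ δC - min δ δC / 2 := by linarith [min_le_right δ δC]
  have hpt : ∀ (b'' : PBond P 0) (b₁ b₂ : PBond P j),
      |h b b₁ * C b₁ b₂ * h' b'' b₂| * Real.exp (min δ δC / 2 * kdist (P := P) k b'' b) ≤
        M * M' * MC * Real.exp (-(min δ δC / 2 * distEU P j b.src b₁.src)) *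
          Real.exp (-(min δ δC / 2 * (supDist b₁.src b₂.src : ℝ))) * Real.exp (-(min δ δC / 2 * distEU P j b''.src b₂.src)) := by
    intro b'' b₁ b₂
    have h1 := hH b b₁
    have h2 := hH' b'' b₂
    have h3 := hC b₁ b₂
    have htri := kdist_le_legs hj hjk b b'' b₁ b₂
    have hd1 : 0 ≤ distEU P j b.src b₁.src := div_nonneg (Nat.cast_nonneg _) (cast_pow_L_pos' j).le
    have hd2 : 0 ≤ (supDist b₁.src b₂.src : ℝ) := Nat.cast_nonneg _
    have hd3 : 0 ≤ distEU P j b''.src b₂.src := div_nonneg (Nat.cast_nonneg _) (cast_pow_L_pos' j).le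
    have hprod : |h b b₁| * |C b₁ b₂| * |h' b'' b₂| ≤ (M * Real.exp (-(δ * distEU P j b.src b₁.src))) *
        (MC * Real.exp (-(δC * (supDist b₁.src b₂.src : ℝ)))) * (M' * Real.exp (-(δ * distEU P j b''.src b₂.src))) :=
      mul_le_mul (mul_le_mul h1 h3 (abs_nonneg _) (by positivity)) h2 (abs_nonneg _) (by positivity)
    have hexp : Real.exp (-(δ * distEU P j b.src b₁.src)) * Real.exp (-(δC * (supDist b₁.src b₂.src : ℝ))) *
        Real.exp (-(δ * distEU P j b''.src b₂.src)) * Real.exp (min δ δC / 2 * kdist (P := P) k b'' b) ≤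
        Real.exp (-(min δ δC / 2 * distEU P j b.src b₁.src)) * Real.exp (-(min δ δC / 2 * (supDist b₁.src b₂.src : ℝ))) *
          Real.exp (-(min δ δC / 2 * distEU P j b''.src b₂.src)) := by
      rw [← Real.exp_add, ← Real.exp_add, ← Real.exp_add, ← Real.exp_add, ← Real.exp_add]
      refine Real.exp_le_exp.2 ?_
      have w := mul_le_mul_of_nonneg_left htri ha.le
      nlinarith [mul_le_mul_of_nonneg_right haδ hd1, mul_le_mul_of_nonneg_right haC hd2, mul_le_mul_of_nonneg_right haδ hd3]
    rw [abs_mul, abs_mul]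
    calc |h b b₁| * |C b₁ b₂| * |h' b'' b₂| * Real.exp (min δ δC / 2 * kdist (P := P) k b'' b)
        ≤ (M * Real.exp (-(δ * distEU P j b.src b₁.src))) * (MC * Real.exp (-(δC * (supDist b₁.src b₂.src : ℝ)))) *
            (M' * Real.exp (-(δ * distEU P j b''.src b₂.src))) * Real.exp (min δ δC / 2 * kdist (P := P) k b'' b) :=
          mul_le_mul_of_nonneg_right hprod (Real.exp_pos _).le
      _ = M * M' * MC * (Real.exp (-(δ * distEU P j b.src b₁.src)) * Real.exp (-(δC * (supDist b₁.src b₂.src : ℝ))) *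
            Real.exp (-(δ * distEU P j b''.src b₂.src)) * Real.exp (min δ δC / 2 * kdist (P := P) k b'' b)) := by ring
      _ ≤ M * M' * MC * (Real.exp (-(min δ δC / 2 * distEU P j b.src b₁.src)) *
            Real.exp (-(min δ δC / 2 * (supDist b₁.src b₂.src : ℝ))) * Real.exp (-(min δ δC / 2 * distEU P j b''.src b₂.src))) :=
          mul_le_mul_of_nonneg_left hexp (by positivity)
      _ = _ := by ring
  have hS3 : ∀ b₂ : PBond P j, ∑ b'' : PBond P 0, Real.exp (-(min δ δC / 2 * distEU P j b''.src b₂.src)) ≤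
      (P.d : ℝ) * (((P.L : ℝ) ^ j) ^ P.d * (2 * (1 + P.d / (min δ δC / 2))) ^ P.d) := fun b₂ => sum_fineBond_exp_le j ha b₂.src
  have hS2 : ∀ b₁ : PBond P j, ∑ b₂ : PBond P j, Real.exp (-(min δ δC / 2 * (supDist b₁.src b₂.src : ℝ))) ≤
      (P.d : ℝ) * (2 * (1 + P.d / (min δ δC / 2))) ^ P.d := fun b₁ => sum_bond_exp_neg_supDist_le j ha b₁
  have hS1 : ∑ b₁ : PBond P j, Real.exp (-(min δ δC / 2 * distEU P j b.src b₁.src)) ≤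
      (P.d : ℝ) * (Real.exp (min δ δC / 2 / 2) * (2 * (1 + P.d / (min δ δC / 2))) ^ P.d) := sum_bond_exp_neg_distEU_le hj ha b.src
  have hx : ∀ G : PBond P 0 → PBond P j → PBond P j → ℝ,
      ∑ b'' : PBond P 0, ∑ b₁ : PBond P j, ∑ b₂ : PBond P j, G b'' b₁ b₂ =
        ∑ b₁ : PBond P j, ∑ b₂ : PBond P j, ∑ b'' : PBond P 0, G b'' b₁ b₂ := by
    intro G
    rw [Finset.sum_comm]
    exact Finset.sum_congr rfl fun b₁ _ => Finset.sum_comm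
  set K : ℝ := (2 * (1 + P.d / (min δ δC / 2))) ^ P.d with hK
  have hK0 : 0 ≤ K := by positivity
  calc ∑ b'' : PBond P 0, |∑ b₁ : PBond P j, ∑ b₂ : PBond P j, h b b₁ * C b₁ b₂ * h' b'' b₂| *
          Real.exp (min δ δC / 2 * kdist (P := P) k b'' b)
      ≤ ∑ b'' : PBond P 0, (∑ b₁ : PBond P j, ∑ b₂ : PBond P j, |h b b₁ * C b₁ b₂ * h' b'' b₂|) *
          Real.exp (min δ δC / 2 * kdist (P := P) k b'' b) :=
        Finset.sum_le_sum fun b'' _ => mul_le_mul_of_nonneg_right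
          ((Finset.abs_sum_le_sum_abs _ _).trans (Finset.sum_le_sum fun b₁ _ => Finset.abs_sum_le_sum_abs _ _)) (Real.exp_pos _).le
    _ = ∑ b'' : PBond P 0, ∑ b₁ : PBond P j, ∑ b₂ : PBond P j, |h b b₁ * C b₁ b₂ * h' b'' b₂| *
          Real.exp (min δ δC / 2 * kdist (P := P) k b'' b) := by
        refine Finset.sum_congr rfl fun b'' _ => ?_
        rw [Finset.sum_mul]
        exact Finset.sum_congr rfl fun b₁ _ => Finset.sum_mul _ _ _
    _ ≤ ∑ b'' : PBond P 0, ∑ b₁ : PBond P j, ∑ b₂ : PBond P j, M * M' * MC * Real.exp (-(min δ δC / 2 * distEU P j b.src b₁.src)) *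
          Real.exp (-(min δ δC / 2 * (supDist b₁.src b₂.src : ℝ))) * Real.exp (-(min δ δC / 2 * distEU P j b''.src b₂.src)) :=
        Finset.sum_le_sum fun b'' _ => Finset.sum_le_sum fun b₁ _ => Finset.sum_le_sum fun b₂ _ => hpt b'' b₁ b₂
    _ = ∑ b₁ : PBond P j, ∑ b₂ : PBond P j, (M * M' * MC * Real.exp (-(min δ δC / 2 * distEU P j b.src b₁.src)) *
          Real.exp (-(min δ δC / 2 * (supDist b₁.src b₂.src : ℝ)))) *
          ∑ b'' : PBond P 0, Real.exp (-(min δ δC / 2 * distEU P j b''.src b₂.src)) := by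
        rw [hx]
        refine Finset.sum_congr rfl fun b₁ _ => Finset.sum_congr rfl fun b₂ _ => ?_
        rw [Finset.mul_sum]
    _ ≤ ∑ b₁ : PBond P j, ∑ b₂ : PBond P j, (M * M' * MC * Real.exp (-(min δ δC / 2 * distEU P j b.src b₁.src)) *
          Real.exp (-(min δ δC / 2 * (supDist b₁.src b₂.src : ℝ)))) * ((P.d : ℝ) * (((P.L : ℝ) ^ j) ^ P.d * K)) :=
        Finset.sum_le_sum fun b₁ _ => Finset.sum_le_sum fun b₂ _ => mul_le_mul_of_nonneg_left (hS3 b₂) (by positivity)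
    _ = ∑ b₁ : PBond P j, (M * M' * MC * ((P.d : ℝ) * (((P.L : ℝ) ^ j) ^ P.d * K)) *
          Real.exp (-(min δ δC / 2 * distEU P j b.src b₁.src))) *
          ∑ b₂ : PBond P j, Real.exp (-(min δ δC / 2 * (supDist b₁.src b₂.src : ℝ))) := by
        refine Finset.sum_congr rfl fun b₁ _ => ?_
        rw [Finset.mul_sum]
        exact Finset.sum_congr rfl fun b₂ _ => by ring
    _ ≤ ∑ b₁ : PBond P j, (M * M' * MC * ((P.d : ℝ) * (((P.L : ℝ) ^ j) ^ P.d * K)) *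
          Real.exp (-(min δ δC / 2 * distEU P j b.src b₁.src))) * ((P.d : ℝ) * K) :=
        Finset.sum_le_sum fun b₁ _ => mul_le_mul_of_nonneg_left (hS2 b₁) (by positivity)
    _ = (M * M' * MC * ((P.d : ℝ) * (((P.L : ℝ) ^ j) ^ P.d * K)) * ((P.d : ℝ) * K)) *
          ∑ b₁ : PBond P j, Real.exp (-(min δ δC / 2 * distEU P j b.src b₁.src)) := by
        rw [Finset.mul_sum]
        exact Finset.sum_congr rfl fun b₁ _ => by ring
    _ ≤ (M * M' * MC * ((P.d : ℝ) * (((P.L : ℝ) ^ j) ^ P.d * K)) * ((P.d : ℝ) * K)) *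
          ((P.d : ℝ) * (Real.exp (min δ δC / 2 / 2) * K)) := mul_le_mul_of_nonneg_left hS1 (by positivity)
    _ = _ := by ring

end Generic

/-! ## §2  The object of record: row sums of the `η`-derivative `≲ (L^{k−j})^{−1}` -/

section Object

variable {P : Params}

/-- **THE SCALE-`j` TERM OF THE `η`-DERIVATIVE WITH THE `η^d` WEIGHT** (`j ≤ k`, `j ≤ m + K`, `d ≥ 2`, radius `ρ_j > 0`): given the sup and
gradient members of (7.2.2) for `H_j`, a (2.5)-analogue bound for the `C^{(j)}_{loc}` of record at radius `ρ_j/4` and a slope constant `C_σ` of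
the cutoff profile, `Σ_{b″} η_k^dL^k|G^{(j),η}_{loc}(⟨x+e_λ,μ⟩,b″) − G^{(j),η}_{loc}(⟨x,μ⟩,b″)|e^{a·dist_k(b″,⟨x,μ⟩)} ≤
(1 + 16C_σ/ρ_j)M²M_C·d³e^{a/2}K(a)³·(L^{k−j})^{−1}` — §1 with `h = Δ_λH_{j,loc}` (file E1's `abs_hlKer_shift_sub_le`), `h′ = H_{j,loc}`,
`C = C^{(j),L^jη}_{loc}`, and `η_k^d(L^{k−j})^{d−2}(L^j)^d·L^k/L^j = (L^{k−j})^{−1}`. [cite: BalabanImbrieJaffe1988, (2.13) p.261] -/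
theorem weighted_rowsum_gradTermLoc_le (hd : 2 ≤ P.d) {k j : ℕ} (hj : j ≤ P.m + P.K) (hjk : j ≤ k) {a : ℝ} (ha : 0 < a)
    {δ M δC MC : ℝ} (hδ : 0 < δ) (hδC : 0 < δC) (hMC : 0 ≤ MC)
    (hH : ∀ (μ ν : Fin P.d) (x : TSite P 0) (y : TSite P j),
      |(torusRep P j (deltaAData hj a)).H (x, μ) (y, ν)| ≤ M * Real.exp (-(δ * distEU P j x y)))
    (hB : ∀ (μ ν : Fin P.d) (x : TSite P 0) (y : TSite P j),
      ‖fun lam : Fin P.d => (P.L : ℝ) ^ j *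
          ((torusRep P j (deltaAData hj a)).H (x.shift lam, μ) (y, ν) - (torusRep P j (deltaAData hj a)).H (x, μ) (y, ν))‖ ≤
        M * Real.exp (-(δ * distEU P j x y)))
    {C : ℝ} (hC0 : 0 ≤ C) (hCζ : ∀ (R₁ R₀ : ℝ), R₁ < R₀ → ∀ t s : ℝ,
      |cutoffProfile R₁ R₀ t - cutoffProfile R₁ R₀ s| ≤ C / (R₀ - R₁) * |t - s|)
    (ρ : ℕ → ℝ) (hρ : 0 < ρ j)
    (hCl : ∀ b₁ b₂ : PBond P j, |Cloc P j (ρ j / 4) b₁ b₂| ≤ MC * Real.exp (-(δC * (supDist b₁.src b₂.src : ℝ))))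
    (x : TSite P 0) (μ lam : Fin P.d) :
    ∑ b'' : PBond P 0, (P.eta k) ^ P.d * (P.L : ℝ) ^ k *
        |termKer (P := P) ((P.eta k) ^ P.d) ((P.L : ℝ) ^ k) ρ j ⟨x.shift lam, μ⟩ b'' -
          termKer (P := P) ((P.eta k) ^ P.d) ((P.L : ℝ) ^ k) ρ j ⟨x, μ⟩ b''| *
        Real.exp (min δ δC / 2 * kdist (P := P) k b'' ⟨x, μ⟩) ≤
      (1 + 16 * C / ρ j) * (M ^ 2 * MC * (P.d : ℝ) ^ 3 *
        (Real.exp (min δ δC / 2 / 2) * ((2 * (1 + P.d / (min δ δC / 2))) ^ P.d) ^ 3)) * ((P.L : ℝ) ^ (k - j))⁻¹ := by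
  have hw : 0 < (P.eta k) ^ P.d := pow_pos (eta_pos P k) _
  have hc : (P.L : ℝ) ^ k ≠ 0 := (cast_pow_L_pos' k).ne'
  have hLk : 0 < (P.L : ℝ) ^ k := cast_pow_L_pos' k
  have hLj : 0 < (P.L : ℝ) ^ j := cast_pow_L_pos' j
  have hM : 0 ≤ M := by
    have h := hH ⟨0, P.hd⟩ ⟨0, P.hd⟩ default default
    exact (mul_nonneg_iff_of_pos_right (Real.exp_pos _)).1 ((abs_nonneg _).trans h)
  have hR : ρ j / 16 < ρ j / 8 := by linarith
  have hRw : ρ j / 8 - ρ j / 16 = ρ j / 16 := by ring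
  have hMC' : 0 ≤ MC * ((P.L : ℝ) ^ (k - j)) ^ (P.d - 2) := mul_nonneg hMC (pow_pos (cast_pow_L_pos' _) _).le
  have hfac : 0 ≤ 1 + 16 * C / ρ j := by positivity
  -- the differenced kernel and its bound at the unshifted point
  have hDiff : ∀ (b₀ : PBond P 0) (b₁ : PBond P j),
      |(fun (b₀ : PBond P 0) (b₁ : PBond P j) => hlKer (P := P) ((P.eta k) ^ P.d) ((P.L : ℝ) ^ k) (ρ j / 16) (ρ j / 8) j
          ⟨b₀.src.shift lam, b₀.dir⟩ b₁ - hlKer (P := P) ((P.eta k) ^ P.d) ((P.L : ℝ) ^ k) (ρ j / 16) (ρ j / 8) j b₀ b₁) b₀ b₁| ≤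
        ((P.L : ℝ) ^ j)⁻¹ * (M * (1 + 16 * C / ρ j)) * Real.exp (-(δ * distEU P j b₀.src b₁.src)) := by
    intro b₀ b₁
    have h := abs_hlKer_shift_sub_le hj hw hc ha hH hB hC0 hR (hCζ _ _ hR) b₀.src b₀.dir lam b₁
    rw [hRw] at h
    have e16 : C / (ρ j / 16) = 16 * C / ρ j := by field_simp
    rw [e16] at h
    exact h
  have h3 := weighted_rowsum_triple_le₂ (k := k) hj hjk hδ hδC (by positivity : 0 ≤ ((P.L : ℝ) ^ j)⁻¹ * (M * (1 + 16 * C / ρ j))) hM hMC'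
    hDiff (abs_hlKer_le_of_sup hj hw hc ha hH (ρ j / 16) (ρ j / 8)) (abs_clKer_ambient_le hd hjk hCl) ⟨x, μ⟩
  -- rewrite the summand through the differenced scale term and pull the constant weight out
  have e : ∀ b'' : PBond P 0, (P.eta k) ^ P.d * (P.L : ℝ) ^ k *
      |termKer (P := P) ((P.eta k) ^ P.d) ((P.L : ℝ) ^ k) ρ j ⟨x.shift lam, μ⟩ b'' -
        termKer (P := P) ((P.eta k) ^ P.d) ((P.L : ℝ) ^ k) ρ j ⟨x, μ⟩ b''| * Real.exp (min δ δC / 2 * kdist (P := P) k b'' ⟨x, μ⟩) =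
      ((P.eta k) ^ P.d * (P.L : ℝ) ^ k) *
        (|∑ b₁ : PBond P j, ∑ b₂ : PBond P j,
            (hlKer (P := P) ((P.eta k) ^ P.d) ((P.L : ℝ) ^ k) (ρ j / 16) (ρ j / 8) j ⟨x.shift lam, μ⟩ b₁ -
                hlKer (P := P) ((P.eta k) ^ P.d) ((P.L : ℝ) ^ k) (ρ j / 16) (ρ j / 8) j ⟨x, μ⟩ b₁) *
              clKer (P := P) ((P.eta k) ^ P.d) ((P.L : ℝ) ^ k) (ρ j / 4) j b₁ b₂ *
              hlKer (P := P) ((P.eta k) ^ P.d) ((P.L : ℝ) ^ k) (ρ j / 16) (ρ j / 8) j b'' b₂| *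
          Real.exp (min δ δC / 2 * kdist (P := P) k b'' ⟨x, μ⟩)) := by
    intro b''; rw [termKer_shift_sub_eq_sum]; ring
  rw [Finset.sum_congr rfl fun b'' _ => e b'', ← Finset.mul_sum]
  have hscal : (P.eta k) ^ P.d * (P.L : ℝ) ^ k * (((P.L : ℝ) ^ j)⁻¹ * ((P.L : ℝ) ^ (k - j)) ^ (P.d - 2) * ((P.L : ℝ) ^ j) ^ P.d) =
      ((P.L : ℝ) ^ (k - j))⁻¹ := by
    have hsc := eta_pow_scaling (P := P) hd hjk
    have hℓ : 0 < (P.L : ℝ) ^ (k - j) := cast_pow_L_pos' _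
    calc (P.eta k) ^ P.d * (P.L : ℝ) ^ k * (((P.L : ℝ) ^ j)⁻¹ * ((P.L : ℝ) ^ (k - j)) ^ (P.d - 2) * ((P.L : ℝ) ^ j) ^ P.d)
        = ((P.L : ℝ) ^ k * ((P.L : ℝ) ^ j)⁻¹) *
            ((P.eta k) ^ P.d * ((P.L : ℝ) ^ (k - j)) ^ (P.d - 2) * ((P.L : ℝ) ^ j) ^ P.d) := by ring
      _ = (P.L : ℝ) ^ (k - j) * (((P.L : ℝ) ^ (k - j)) ^ 2)⁻¹ := by
          rw [hsc, pow_eq_pow_mul_pow' (P := P) hjk, mul_assoc, mul_comm ((P.L : ℝ) ^ j), ← mul_assoc,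
            mul_inv_cancel_right₀ hLj.ne']
      _ = ((P.L : ℝ) ^ (k - j))⁻¹ := by rw [sq, mul_inv, ← mul_assoc, mul_inv_cancel₀ hℓ.ne', one_mul]
  calc (P.eta k) ^ P.d * (P.L : ℝ) ^ k * _
      ≤ (P.eta k) ^ P.d * (P.L : ℝ) ^ k * (((P.L : ℝ) ^ j)⁻¹ * (M * (1 + 16 * C / ρ j)) * M *
          (MC * ((P.L : ℝ) ^ (k - j)) ^ (P.d - 2)) * (P.d : ℝ) ^ 3 *
          (Real.exp (min δ δC / 2 / 2) * ((2 * (1 + P.d / (min δ δC / 2))) ^ P.d) ^ 3) * ((P.L : ℝ) ^ j) ^ P.d) :=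
        mul_le_mul_of_nonneg_left h3 (by positivity)
    _ = (1 + 16 * C / ρ j) * (M ^ 2 * MC * (P.d : ℝ) ^ 3 *
          (Real.exp (min δ δC / 2 / 2) * ((2 * (1 + P.d / (min δ δC / 2))) ^ P.d) ^ 3)) *
          ((P.eta k) ^ P.d * (P.L : ℝ) ^ k * (((P.L : ℝ) ^ j)⁻¹ * ((P.L : ℝ) ^ (k - j)) ^ (P.d - 2) * ((P.L : ℝ) ^ j) ^ P.d)) := by
        ring
    _ = _ := by rw [hscal]

/-- `Σ_{j<k} L^{−(k−j)} ≤ 1` (`L ≥ 2`; induction `S_{k+1} = L⁻¹(S_k + 1)`). [folklore] -/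
private theorem sum_inv_pow_le_one (k : ℕ) : ∑ j ∈ Finset.range k, ((P.L : ℝ) ^ (k - j))⁻¹ ≤ 1 := by
  have hL : (2 : ℝ) ≤ P.L := by exact_mod_cast P.hL.2
  induction k with
  | zero => simp
  | succ k ih =>
    have e : ∑ j ∈ Finset.range (k + 1), ((P.L : ℝ) ^ (k + 1 - j))⁻¹ =
        (P.L : ℝ)⁻¹ * (∑ j ∈ Finset.range k, ((P.L : ℝ) ^ (k - j))⁻¹ + 1) := by
      rw [Finset.sum_range_succ, show k + 1 - k = 1 by omega, pow_one, mul_add, mul_one, Finset.mul_sum]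
      refine congrArg (· + _) (Finset.sum_congr rfl fun j hj => ?_)
      rw [show k + 1 - j = (k - j) + 1 by have := Finset.mem_range.1 hj; omega, pow_succ, mul_inv, mul_comm]
    rw [e]
    calc (P.L : ℝ)⁻¹ * (∑ j ∈ Finset.range k, ((P.L : ℝ) ^ (k - j))⁻¹ + 1) ≤ 2⁻¹ * (1 + 1) :=
          mul_le_mul ((inv_le_inv₀ (by linarith) two_pos).2 hL) (by linarith) (by positivity) (by norm_num)
      _ = 1 := by norm_num

/-- **THE WEIGHTED `η`-LATTICE ROW SUMS OF THE `η`-DERIVATIVE OF `𝒟_{k,loc}` ARE BOUNDED, uniformly in `k ≤ m + K` and in the schedules with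
`ρ_j ≥ ρ₀ > 0`**: `Σ_{b″} η_k^dL^k|𝒟_{k,loc}(⟨x+e_λ,μ⟩,b″) − 𝒟_{k,loc}(⟨x,μ⟩,b″)|e^{a·dist_k(b″,⟨x,μ⟩)} ≤ (1 + 16C_σ/ρ₀)M²M_C·d³e^{a/2}K(a)³` — the scale
terms `≲ (L^{k−j})^{−1}` are summable with no threshold. [cite: BalabanImbrieJaffe1988, (2.13) p.261] -/
theorem weighted_rowsum_gradDkLoc_le (hd : 2 ≤ P.d) {k : ℕ} (hk : k ≤ P.m + P.K) {a : ℝ} (ha : 0 < a) {δ M δC MC : ℝ} (hδ : 0 < δ)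
    (hδC : 0 < δC) (hMC : 0 ≤ MC)
    (hH : ∀ (j : ℕ) (hj : j ≤ P.m + P.K), j < k → ∀ (μ ν : Fin P.d) (x : TSite P 0) (y : TSite P j),
      |(torusRep P j (deltaAData hj a)).H (x, μ) (y, ν)| ≤ M * Real.exp (-(δ * distEU P j x y)))
    (hB : ∀ (j : ℕ) (hj : j ≤ P.m + P.K), j < k → ∀ (μ ν : Fin P.d) (x : TSite P 0) (y : TSite P j),
      ‖fun lam : Fin P.d => (P.L : ℝ) ^ j *
          ((torusRep P j (deltaAData hj a)).H (x.shift lam, μ) (y, ν) - (torusRep P j (deltaAData hj a)).H (x, μ) (y, ν))‖ ≤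
        M * Real.exp (-(δ * distEU P j x y)))
    {C : ℝ} (hC0 : 0 ≤ C) (hCζ : ∀ (R₁ R₀ : ℝ), R₁ < R₀ → ∀ t s : ℝ,
      |cutoffProfile R₁ R₀ t - cutoffProfile R₁ R₀ s| ≤ C / (R₀ - R₁) * |t - s|)
    (ρ : ℕ → ℝ) {ρ₀ : ℝ} (hρ₀ : 0 < ρ₀) (hρ : ∀ j < k, ρ₀ ≤ ρ j)
    (hCl : ∀ j < k, ∀ b₁ b₂ : PBond P j, |Cloc P j (ρ j / 4) b₁ b₂| ≤ MC * Real.exp (-(δC * (supDist b₁.src b₂.src : ℝ))))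
    (x : TSite P 0) (μ lam : Fin P.d) :
    ∑ b'' : PBond P 0, (P.eta k) ^ P.d * (P.L : ℝ) ^ k *
        |dkLocKer (P := P) ((P.eta k) ^ P.d) ((P.L : ℝ) ^ k) ρ k ⟨x.shift lam, μ⟩ b'' -
          dkLocKer (P := P) ((P.eta k) ^ P.d) ((P.L : ℝ) ^ k) ρ k ⟨x, μ⟩ b''| *
        Real.exp (min δ δC / 2 * kdist (P := P) k b'' ⟨x, μ⟩) ≤
      (1 + 16 * C / ρ₀) * (M ^ 2 * MC * (P.d : ℝ) ^ 3 *
        (Real.exp (min δ δC / 2 / 2) * ((2 * (1 + P.d / (min δ δC / 2))) ^ P.d) ^ 3)) := by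
  have hw : 0 ≤ (P.eta k) ^ P.d * (P.L : ℝ) ^ k := (mul_pos (pow_pos (eta_pos P k) _) (cast_pow_L_pos' k)).le
  set S : ℝ := M ^ 2 * MC * (P.d : ℝ) ^ 3 * (Real.exp (min δ δC / 2 / 2) * ((2 * (1 + P.d / (min δ δC / 2))) ^ P.d) ^ 3) with hS
  have hS0 : 0 ≤ S := by positivity
  have hfac0 : 0 ≤ 1 + 16 * C / ρ₀ := by positivity
  have hterm : ∀ j ∈ Finset.range k, ∑ b'' : PBond P 0, (P.eta k) ^ P.d * (P.L : ℝ) ^ k *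
      |termKer (P := P) ((P.eta k) ^ P.d) ((P.L : ℝ) ^ k) ρ j ⟨x.shift lam, μ⟩ b'' -
        termKer (P := P) ((P.eta k) ^ P.d) ((P.L : ℝ) ^ k) ρ j ⟨x, μ⟩ b''| * Real.exp (min δ δC / 2 * kdist (P := P) k b'' ⟨x, μ⟩) ≤
        (1 + 16 * C / ρ₀) * S * ((P.L : ℝ) ^ (k - j))⁻¹ := by
    intro j hjm
    have hjk : j < k := Finset.mem_range.1 hjm
    have hj : j ≤ P.m + P.K := by omega
    have hρj : 0 < ρ j := lt_of_lt_of_le hρ₀ (hρ j hjk)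
    have hfac : 1 + 16 * C / ρ j ≤ 1 + 16 * C / ρ₀ := by
      have := div_le_div_of_nonneg_left (by positivity : 0 ≤ 16 * C) hρ₀ (hρ j hjk)
      linarith
    refine (weighted_rowsum_gradTermLoc_le hd hj hjk.le ha hδ hδC hMC (hH j hj hjk) (hB j hj hjk) hC0 hCζ ρ hρj (hCl j hjk) x μ lam).trans ?_
    exact mul_le_mul_of_nonneg_right (mul_le_mul_of_nonneg_right hfac hS0) (inv_pos.2 (cast_pow_L_pos' _)).le
  calc ∑ b'' : PBond P 0, (P.eta k) ^ P.d * (P.L : ℝ) ^ k *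
          |dkLocKer (P := P) ((P.eta k) ^ P.d) ((P.L : ℝ) ^ k) ρ k ⟨x.shift lam, μ⟩ b'' -
            dkLocKer (P := P) ((P.eta k) ^ P.d) ((P.L : ℝ) ^ k) ρ k ⟨x, μ⟩ b''| * Real.exp (min δ δC / 2 * kdist (P := P) k b'' ⟨x, μ⟩)
      ≤ ∑ b'' : PBond P 0, ∑ j ∈ Finset.range k, (P.eta k) ^ P.d * (P.L : ℝ) ^ k *
          |termKer (P := P) ((P.eta k) ^ P.d) ((P.L : ℝ) ^ k) ρ j ⟨x.shift lam, μ⟩ b'' -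
            termKer (P := P) ((P.eta k) ^ P.d) ((P.L : ℝ) ^ k) ρ j ⟨x, μ⟩ b''| * Real.exp (min δ δC / 2 * kdist (P := P) k b'' ⟨x, μ⟩) := by
        refine Finset.sum_le_sum fun b'' _ => ?_
        rw [dkLocKer_eq_sum, dkLocKer_eq_sum, ← Finset.sum_sub_distrib, ← Finset.sum_mul, ← Finset.mul_sum]
        exact mul_le_mul_of_nonneg_right (mul_le_mul_of_nonneg_left (Finset.abs_sum_le_sum_abs _ _) hw) (Real.exp_pos _).le
    _ = ∑ j ∈ Finset.range k, ∑ b'' : PBond P 0, (P.eta k) ^ P.d * (P.L : ℝ) ^ k *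
          |termKer (P := P) ((P.eta k) ^ P.d) ((P.L : ℝ) ^ k) ρ j ⟨x.shift lam, μ⟩ b'' -
            termKer (P := P) ((P.eta k) ^ P.d) ((P.L : ℝ) ^ k) ρ j ⟨x, μ⟩ b''| * Real.exp (min δ δC / 2 * kdist (P := P) k b'' ⟨x, μ⟩) :=
        Finset.sum_comm
    _ ≤ ∑ j ∈ Finset.range k, (1 + 16 * C / ρ₀) * S * ((P.L : ℝ) ^ (k - j))⁻¹ := Finset.sum_le_sum hterm
    _ = (1 + 16 * C / ρ₀) * S * ∑ j ∈ Finset.range k, ((P.L : ℝ) ^ (k - j))⁻¹ := by rw [Finset.mul_sum]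
    _ ≤ (1 + 16 * C / ρ₀) * S * 1 := mul_le_mul_of_nonneg_left (sum_inv_pow_le_one k) (by positivity)
    _ = _ := by rw [mul_one]

/-! ## §3  The derivative clause of (2.13) as printed, for the object of record -/

/-- **the `η`-derivative of `𝒟_{k,loc}f` is the operator of the `η`-differenced kernel**: `L^k((Kf)(⟨x+e_λ,μ⟩) − (Kf)(⟨x,μ⟩)) =
(K_Δf)(⟨x,μ⟩)` with `K_Δ(b,b″) = L^k(K(⟨b₋+e_λ,b_dir⟩,b″) − K(b,b″))` (linearity of r18's `applyK`). [cite: BalabanImbrieJaffe1988, (2.13) p.261] -/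
theorem applyK_shift_sub (K : PBond P 0 → PBond P 0 → ℝ) (c : ℝ) (f : PBond P 0 → ℝ) (x : TSite P 0) (μ lam : Fin P.d) :
    c * (applyK K f ⟨x.shift lam, μ⟩ - applyK K f ⟨x, μ⟩) =
      applyK (fun (b : PBond P 0) (b'' : PBond P 0) => c * (K ⟨b.src.shift lam, b.dir⟩ b'' - K b b'')) f ⟨x, μ⟩ := by
  unfold applyK
  rw [← Finset.sum_sub_distrib, Finset.mul_sum]
  exact Finset.sum_congr rfl fun b'' _ => by ring

/-- **THE DERIVATIVE CLAUSE OF (2.13) FOR THE CONCRETE `𝒟_{k,loc}`, EXPLICIT CONSTANTS, ALL `x, μ, λ`**: with the `η`-lattice action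
`(𝒟_{k,loc}f)(b) = Σ_{b″}η_k^d𝒟_{k,loc}(b,b″)f(b″)` of file B, `L^k·|(𝒟_{k,loc}f)(⟨x+e_λ,μ⟩) − (𝒟_{k,loc}f)(⟨x,μ⟩)| ≤
(1 + 16C_σ/ρ₀)M²M_C·d³e^{a/2}K(a)³·e^{−a·dist_k(suppt f,⟨x,μ⟩)}·‖f‖_∞`, `a = min(δ,δ_C)/2`, every `k ≤ m + K`, every schedule with `ρ_j ≥ ρ₀ > 0` —
*"and similarly for derivatives of 𝒟_{k,loc}"*. [cite: BalabanImbrieJaffe1988, (2.13) p.261] -/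
theorem abs_apply_gradDkLoc_le (hd : 2 ≤ P.d) {k : ℕ} (hk : k ≤ P.m + P.K) {a : ℝ} (ha : 0 < a) {δ M δC MC : ℝ} (hδ : 0 < δ)
    (hδC : 0 < δC) (hMC : 0 ≤ MC)
    (hH : ∀ (j : ℕ) (hj : j ≤ P.m + P.K), j < k → ∀ (μ ν : Fin P.d) (x : TSite P 0) (y : TSite P j),
      |(torusRep P j (deltaAData hj a)).H (x, μ) (y, ν)| ≤ M * Real.exp (-(δ * distEU P j x y)))
    (hB : ∀ (j : ℕ) (hj : j ≤ P.m + P.K), j < k → ∀ (μ ν : Fin P.d) (x : TSite P 0) (y : TSite P j),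
      ‖fun lam : Fin P.d => (P.L : ℝ) ^ j *
          ((torusRep P j (deltaAData hj a)).H (x.shift lam, μ) (y, ν) - (torusRep P j (deltaAData hj a)).H (x, μ) (y, ν))‖ ≤
        M * Real.exp (-(δ * distEU P j x y)))
    {C : ℝ} (hC0 : 0 ≤ C) (hCζ : ∀ (R₁ R₀ : ℝ), R₁ < R₀ → ∀ t s : ℝ,
      |cutoffProfile R₁ R₀ t - cutoffProfile R₁ R₀ s| ≤ C / (R₀ - R₁) * |t - s|)
    (ρ : ℕ → ℝ) {ρ₀ : ℝ} (hρ₀ : 0 < ρ₀) (hρ : ∀ j < k, ρ₀ ≤ ρ j)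
    (hCl : ∀ j < k, ∀ b₁ b₂ : PBond P j, |Cloc P j (ρ j / 4) b₁ b₂| ≤ MC * Real.exp (-(δC * (supDist b₁.src b₂.src : ℝ))))
    (f : PBond P 0 → ℝ) (x : TSite P 0) (μ lam : Fin P.d) :
    (P.L : ℝ) ^ k * |applyK (fun b b'' => (P.eta k) ^ P.d * dkLocKer (P := P) ((P.eta k) ^ P.d) ((P.L : ℝ) ^ k) ρ k b b'') f
          ⟨x.shift lam, μ⟩ -
        applyK (fun b b'' => (P.eta k) ^ P.d * dkLocKer (P := P) ((P.eta k) ^ P.d) ((P.L : ℝ) ^ k) ρ k b b'') f ⟨x, μ⟩| ≤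
      (1 + 16 * C / ρ₀) * (M ^ 2 * MC * (P.d : ℝ) ^ 3 *
          (Real.exp (min δ δC / 2 / 2) * ((2 * (1 + P.d / (min δ δC / 2))) ^ P.d) ^ 3)) *
        Real.exp (-(min δ δC / 2) * suppDist (fun a b => kdist (P := P) k a b) f ⟨x, μ⟩) * supNorm f := by
  have hLk : 0 < (P.L : ℝ) ^ k := cast_pow_L_pos' k
  have hw : 0 ≤ (P.eta k) ^ P.d := (pow_pos (eta_pos P k) _).le
  have ha₀ : 0 ≤ min δ δC / 2 := (half_pos (lt_min hδ hδC)).le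
  rw [mul_abs_of_pos hLk, applyK_shift_sub]
  refine abs_applyK_le_of_weighted_rowsum (dist := fun a b => kdist (P := P) k a b) ha₀ ?_ f
  have e : ∀ b'' : PBond P 0,
      |(P.L : ℝ) ^ k * ((P.eta k) ^ P.d * dkLocKer (P := P) ((P.eta k) ^ P.d) ((P.L : ℝ) ^ k) ρ k ⟨x.shift lam, μ⟩ b'' -
          (P.eta k) ^ P.d * dkLocKer (P := P) ((P.eta k) ^ P.d) ((P.L : ℝ) ^ k) ρ k ⟨x, μ⟩ b'')| =
        (P.eta k) ^ P.d * (P.L : ℝ) ^ k *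
          |dkLocKer (P := P) ((P.eta k) ^ P.d) ((P.L : ℝ) ^ k) ρ k ⟨x.shift lam, μ⟩ b'' -
            dkLocKer (P := P) ((P.eta k) ^ P.d) ((P.L : ℝ) ^ k) ρ k ⟨x, μ⟩ b''| := by
    intro b''
    rw [← mul_sub, ← mul_assoc, abs_mul, abs_of_nonneg (mul_nonneg hLk.le hw), mul_comm ((P.L : ℝ) ^ k)]
  simp only [e]
  exact weighted_rowsum_gradDkLoc_le hd hk ha hδ hδC hMC hH hB hC0 hCζ ρ hρ₀ hρ hCl x μ lam

/-- **THE DERIVATIVE CLAUSE OF (2.13) ON A TORUS FROM THE TYPED (7.2.2)** (r15's `KernelData.Ineq722` for p09's kernel family; `C^{(j)}_{loc}`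
input p09 g8's `cloc_decay`; cutoff slope file E1): `∃ c₂ δ′, 0 < δ′ ∧ 0 ≤ c₂ ∧ ∀ k ≤ m + K, ∀ ρ (ρ_j ≥ ρ₀, j < k), ∀ f x μ λ,
L^k·|(𝒟_{k,loc}f)(⟨x+e_λ,μ⟩) − (𝒟_{k,loc}f)(⟨x,μ⟩)| ≤ c₂e^{−δ′dist_k(suppt f,⟨x,μ⟩)}‖f‖_∞`. [cite: BalabanImbrieJaffe1988, (2.13) p.261] -/
theorem opDecay213_gradDkLoc_of_ineq722 (hd : 2 ≤ P.d) {lev : ℕ → ℕ} (hlev : ∀ i, lev i ≤ P.m + P.K)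
    (hcov : ∀ j ≤ P.m + P.K, ∃ i, lev i = j) {a : ℝ} {BondU : ℕ → Type}
    {distEB : (i : ℕ) → TSite P 0 → BondU i → ℝ} {Cker : (i : ℕ) → Fin P.d → Fin P.d → TSite P (lev i) → TSite P (lev i) → ℝ}
    {Dker : (i : ℕ) → TSite P 0 → BondU i → ℝ}
    (h722 : KernelData.Ineq722
      (fun i => torusKernelData P (lev i) (deltaAData (hlev i) a) (BondU i) (distEB i) (Cker i) (Dker i))) (ha : 0 < a)
    {ρ₀ : ℝ} (hρ₀ : 0 < ρ₀) :
    ∃ c₂ δ' : ℝ, 0 < δ' ∧ 0 ≤ c₂ ∧ ∀ (k : ℕ) (_ : k ≤ P.m + P.K) (ρ : ℕ → ℝ) (_ : ∀ j < k, ρ₀ ≤ ρ j)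
      (f : PBond P 0 → ℝ) (x : TSite P 0) (μ lam : Fin P.d),
        (P.L : ℝ) ^ k * |applyK (fun b b'' => (P.eta k) ^ P.d * dkLocKer (P := P) ((P.eta k) ^ P.d) ((P.L : ℝ) ^ k) ρ k b b'') f
              ⟨x.shift lam, μ⟩ -
            applyK (fun b b'' => (P.eta k) ^ P.d * dkLocKer (P := P) ((P.eta k) ^ P.d) ((P.L : ℝ) ^ k) ρ k b b'') f ⟨x, μ⟩| ≤
          c₂ * Real.exp (-δ' * suppDist (fun a b => kdist (P := P) k a b) f ⟨x, μ⟩) * supNorm f := by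
  obtain ⟨δ, M, hδ, -, hBall⟩ := exists_bound_of_ineq722 hlev h722
  obtain ⟨MC, δC, hMC, hδC, HC⟩ := cloc_decay P.d P.L hd
  obtain ⟨C, hC0, hCζ⟩ := exists_cutoffProfile_lipschitz
  refine ⟨(1 + 16 * C / ρ₀) * (M ^ 2 * MC * (P.d : ℝ) ^ 3 *
      (Real.exp (min δ δC / 2 / 2) * ((2 * (1 + P.d / (min δ δC / 2))) ^ P.d) ^ 3)),
    min δ δC / 2, half_pos (lt_min hδ hδC), by positivity, fun k hk ρ hρ f x μ lam => ?_⟩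
  have hH : ∀ (j : ℕ) (hj : j ≤ P.m + P.K), j < k → ∀ (μ ν : Fin P.d) (x : TSite P 0) (y : TSite P j),
      |(torusRep P j (deltaAData hj a)).H (x, μ) (y, ν)| ≤ M * Real.exp (-(δ * distEU P j x y)) := by
    intro j hj _ μ ν x y
    obtain ⟨i, hi⟩ := hcov j hj
    subst hi
    exact (le_add_of_nonneg_right torusKernelData_gradH_nonneg).trans (hBall i μ ν x y)
  have hB : ∀ (j : ℕ) (hj : j ≤ P.m + P.K), j < k → ∀ (μ ν : Fin P.d) (x : TSite P 0) (y : TSite P j),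
      ‖fun lam : Fin P.d => (P.L : ℝ) ^ j *
          ((torusRep P j (deltaAData hj a)).H (x.shift lam, μ) (y, ν) - (torusRep P j (deltaAData hj a)).H (x, μ) (y, ν))‖ ≤
        M * Real.exp (-(δ * distEU P j x y)) := by
    intro j hj _ μ ν x y
    obtain ⟨i, hi⟩ := hcov j hj
    subst hi
    have h := hBall i μ ν x y
    rw [torusKernelData_gradH] at h
    exact (le_add_of_nonneg_left (abs_nonneg _)).trans h
  have hCl : ∀ j < k, ∀ b₁ b₂ : PBond P j,
      |Cloc P j (ρ j / 4) b₁ b₂| ≤ MC * Real.exp (-(δC * (supDist b₁.src b₂.src : ℝ))) := by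
    intro j hjk b₁ b₂
    have h := HC P rfl rfl j inferInstance (by omega) (ρ j / 4) b₁ b₂
    rwa [distB_apply] at h
  exact abs_apply_gradDkLoc_le hd hk ha hδ hδC hMC.le hH hB hC0 hCζ ρ hρ₀ hρ hCl f x μ lam

/-- **THE DERIVATIVE CLAUSE OF (2.13) AS PRINTED, ON A TORUS, GIVEN ONLY [6I] PROPOSITION 1.2 BY ITS TREE NAME** (per-tower `B5.Prop12Printed`
for p09's family `levStd`; radii `ρ_j ≥ ρ₀ > 0`). [cite: BalabanImbrieJaffe1988, (2.13) p.261] -/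
theorem opDecay213_gradDkLoc_prop12 (hd : 2 ≤ P.d) {a : ℝ} (ha : 0 < a)
    (h12 : B5.Prop12Printed (fun i => settingOf (torusRep P (levStd P i) (deltaAData (levStd_le i) a)) i))
    {ρ₀ : ℝ} (hρ₀ : 0 < ρ₀) :
    ∃ c₂ δ' : ℝ, 0 < δ' ∧ 0 ≤ c₂ ∧ ∀ (k : ℕ) (_ : k ≤ P.m + P.K) (ρ : ℕ → ℝ) (_ : ∀ j < k, ρ₀ ≤ ρ j)
      (f : PBond P 0 → ℝ) (x : TSite P 0) (μ lam : Fin P.d),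
        (P.L : ℝ) ^ k * |applyK (fun b b'' => (P.eta k) ^ P.d * dkLocKer (P := P) ((P.eta k) ^ P.d) ((P.L : ℝ) ^ k) ρ k b b'') f
              ⟨x.shift lam, μ⟩ -
            applyK (fun b b'' => (P.eta k) ^ P.d * dkLocKer (P := P) ((P.eta k) ^ P.d) ((P.L : ℝ) ^ k) ρ k b b'') f ⟨x, μ⟩| ≤
          c₂ * Real.exp (-δ' * suppDist (fun a b => kdist (P := P) k a b) f ⟨x, μ⟩) * supNorm f :=
  opDecay213_gradDkLoc_of_ineq722 hd levStd_le (fun j hj => ⟨j, min_eq_left hj⟩)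
    (ineq722_deltaA_of_prop12Printed (levStd P) levStd_le ha (fun _ => PUnit) (fun _ _ _ => 0) (fun _ _ _ _ _ => 0)
      (fun _ _ _ => 0) h12) ha hρ₀

/-- **THE DERIVATIVE CLAUSE OF (2.13) AS PRINTED, ON EVERY TORUS, NO HYPOTHESIS** (`d ≥ 2`, radii `ρ_j ≥ ρ₀ > 0`; p16's
`prop12Printed_levStd_deltaA` discharges the per-tower `h12`; constants per torus, typing note G-C1-07). [cite: BalabanImbrieJaffe1988, (2.13) p.261] -/
theorem opDecay213_gradDkLoc_torus (hd : 2 ≤ P.d) {a : ℝ} (ha : 0 < a) {ρ₀ : ℝ} (hρ₀ : 0 < ρ₀) :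
    ∃ c₂ δ' : ℝ, 0 < δ' ∧ 0 ≤ c₂ ∧ ∀ (k : ℕ) (_ : k ≤ P.m + P.K) (ρ : ℕ → ℝ) (_ : ∀ j < k, ρ₀ ≤ ρ j)
      (f : PBond P 0 → ℝ) (x : TSite P 0) (μ lam : Fin P.d),
        (P.L : ℝ) ^ k * |applyK (fun b b'' => (P.eta k) ^ P.d * dkLocKer (P := P) ((P.eta k) ^ P.d) ((P.L : ℝ) ^ k) ρ k b b'') f
              ⟨x.shift lam, μ⟩ -
            applyK (fun b b'' => (P.eta k) ^ P.d * dkLocKer (P := P) ((P.eta k) ^ P.d) ((P.L : ℝ) ^ k) ρ k b b'') f ⟨x, μ⟩| ≤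
          c₂ * Real.exp (-δ' * suppDist (fun a b => kdist (P := P) k a b) f ⟨x, μ⟩) * supNorm f :=
  opDecay213_gradDkLoc_prop12 hd ha (prop12Printed_levStd_deltaA P a) hρ₀

end Object

/-! ## §4  Over all tori, constants before the torus -/

section AllTori

/-- **THE DERIVATIVE CLAUSE OF (2.13) AS PRINTED, OVER ALL TORI FROM [6I] PROP. 1.2 BY ITS TREE NAME** (`2 ≤ d`, `L` odd `> 1`, radii
`ρ_j ≥ ρ₀ > 0`): ONE `(c₂, δ′)`, `δ′ > 0`, `c₂ ≥ 0`, with `L^k·|(𝒟_{k,loc}f)(⟨x+e_λ,μ⟩) − (𝒟_{k,loc}f)(⟨x,μ⟩)| ≤ c₂e^{−δ′dist_k(suppt f,⟨x,μ⟩)}‖f‖_∞`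
for EVERY torus (`P.d = d`, `P.L = L`), every `k ≤ m + K`, every schedule with `ρ_j ≥ ρ₀`, every `f, x, μ, λ` — *"c … independent of
k, T_η"*. [cite: BalabanImbrieJaffe1988, (2.13) p.261] -/
theorem opDecay213_gradDkLoc_allTori_of_prop12Printed {d L : ℕ} (hd : 2 ≤ d) (hL : Odd L ∧ 1 < L) {a : ℝ} (ha : 0 < a)
    (h12 : B5.Prop12Printed (fun i : {x : Params × ℕ // x.1.d = d ∧ x.1.L = L ∧ 1 ≤ x.2 ∧ x.2 ≤ x.1.m + x.1.K} =>
      settingOf (torusRep i.1.1 i.1.2 (deltaAData i.2.2.2.2 a)) i.1.2))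
    {ρ₀ : ℝ} (hρ₀ : 0 < ρ₀) :
    ∃ c₂ δ' : ℝ, 0 < δ' ∧ 0 ≤ c₂ ∧ ∀ (P : Params) (_ : P.d = d) (_ : P.L = L) (k : ℕ) (_ : k ≤ P.m + P.K) (ρ : ℕ → ℝ)
      (_ : ∀ j < k, ρ₀ ≤ ρ j) (f : PBond P 0 → ℝ) (x : TSite P 0) (μ lam : Fin P.d),
        (P.L : ℝ) ^ k * |applyK (fun b b'' => (P.eta k) ^ P.d * dkLocKer (P := P) ((P.eta k) ^ P.d) ((P.L : ℝ) ^ k) ρ k b b'') f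
              ⟨x.shift lam, μ⟩ -
            applyK (fun b b'' => (P.eta k) ^ P.d * dkLocKer (P := P) ((P.eta k) ^ P.d) ((P.L : ℝ) ^ k) ρ k b b'') f ⟨x, μ⟩| ≤
          c₂ * Real.exp (-δ' * suppDist (fun a b => kdist (P := P) k a b) f ⟨x, μ⟩) * supNorm f := by
  obtain ⟨δ, M, hδ, -, hHB⟩ := exists_HB_allTori_of_prop12Printed (le_trans one_le_two hd) hL ha h12
  obtain ⟨MC, δC, hMC, hδC, HC⟩ := cloc_decay d L hd
  obtain ⟨C, hC0, hCζ⟩ := exists_cutoffProfile_lipschitz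
  refine ⟨(1 + 16 * C / ρ₀) * (M ^ 2 * MC * (d : ℝ) ^ 3 *
      (Real.exp (min δ δC / 2 / 2) * ((2 * (1 + d / (min δ δC / 2))) ^ d) ^ 3)),
    min δ δC / 2, half_pos (lt_min hδ hδC), ?_, fun P hPd hPL k hk ρ hρ f x μ lam => ?_⟩
  · have := lt_min hδ hδC; positivity
  have hH : ∀ (j : ℕ) (hj : j ≤ P.m + P.K), j < k → ∀ (μ ν : Fin P.d) (x'' : TSite P 0) (y : TSite P j),
      |(torusRep P j (deltaAData hj a)).H (x'', μ) (y, ν)| ≤ M * Real.exp (-(δ * distEU P j x'' y)) :=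
    fun j hj _ μ ν x'' y => (hHB P hPd hPL j hj μ ν x'' y).1
  have hB : ∀ (j : ℕ) (hj : j ≤ P.m + P.K), j < k → ∀ (μ ν : Fin P.d) (x : TSite P 0) (y : TSite P j),
      ‖fun lam : Fin P.d => (P.L : ℝ) ^ j *
          ((torusRep P j (deltaAData hj a)).H (x.shift lam, μ) (y, ν) - (torusRep P j (deltaAData hj a)).H (x, μ) (y, ν))‖ ≤
        M * Real.exp (-(δ * distEU P j x y)) :=
    fun j hj _ μ ν x y => (hHB P hPd hPL j hj μ ν x y).2
  have hCl : ∀ j < k, ∀ b₁ b₂ : PBond P j,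
      |Cloc P j (ρ j / 4) b₁ b₂| ≤ MC * Real.exp (-(δC * (supDist b₁.src b₂.src : ℝ))) := by
    intro j hjk b₁ b₂
    have h := HC P hPd hPL j inferInstance (by omega) (ρ j / 4) b₁ b₂
    rwa [distB_apply] at h
  subst hPd
  exact abs_apply_gradDkLoc_le hd hk ha hδ hδC hMC.le hH hB hC0 hCζ ρ hρ₀ hρ hCl f x μ lam

end AllTori

end

end Literature.MathematicalPhysics.QuantumFieldTheory.BalabanImbrieJaffe1984to88.BIJ88OpDecay213DkLocGradTorus
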